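/- v4 (seat rekey-l0-muliuconj-b g1, 2026-08-23 ≈22:55Z, filing edition) = v3 251e0be371d4 (pen muliuconj-a g0) with ONE decl removed:
   `isRep_starRingEnd_comp_left_iff`, a restatement of the meanwhile-landed `HodgeCM.SignRecipe.isRep_starRingEnd_comp_iff`
   (`CorCM/Rekey/Binders/LiftTypeConj.lean`, now imported); its two uses re-pointed; nothing else touched.  HELD; HC_CM is NOT proved. -/
/-
Copyright (c) 2026 the pub-hodgecm2 formalisation cell (harness21).  New file, not vendored.
Origin: seat `pub-hodgecm2-rekey-l0-muliuconj-a` (branch (c-S.1) «MIS-KEY ⇒ re-key», REKEY-FLIPSITES.md §2.2 (F-s) «the theta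
supply's orientation bit»), 2026-08-23.  PRIMED PARALLEL CHAIN: a NEW additive leaf under `CorCM/Rekey/**`; imports the UNPRIMED
✔ `HodgeCM/Model/Binders/JLiuLineType.lean` only (⊇ `Automorphic/EndStateFieldCensus`, `Automorphic/SignRecipe_1`,
`Model/ArchKTypeOfOrient`); no in-place edit of any ported file; nothing imports it yet.
STATUS WORD OF RECORD: HELD pending orientation re-key.  `HC_CM` is NOT proved here or anywhere in this file.
-/
import Summits.HodgeConjecture.HodgeCM.Model.Binders.JLiuLineType
import Summits.HodgeConjecture.CorCM.Rekey.Binders.LiftTypeConj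

set_option autoImplicit false

/-!
# Re-key (c-S.1), the supply guard under conjugation: `GoodCtx h ῑ₁ c ↔ GoodCtx h ι₁ c`

Notation: `ῑ₁ := (starRingEnd ℂ).comp ι₁`, `c_L := conjRingHomK L` (complex conjugation OF `L`).

PerL's model-free good-context predicate `SignRecipe.GoodCtx h ι₁ c` (`Automorphic/EndStateFieldCensus`: pair-sum, injectivity of
the four corner types, `c.σ ∈ Ψ_i`, and `∃ j, ι₁ ∘ j = c.σ ∧ SignsForced h c.K L j ι₁ c.Ψ c.D`) is the guard of EVERY theta model of
record (`AdelicThetaCore.thetaModel_goodCtx_iff`, any core, any side data, recipe bit `h`).  The primed chain (REKEY-FLIPSITES §2.1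
U5, §3bis L2∕L3) re-keys the tower sockets at `ῑ₁`, so their recipe-form guard becomes `SignRecipe.GoodCtx (orientBitι L ῑ₁) ῑ₁ c`
(seats instlevel-a ∕ phimuline-b, L2 fixes), and the open (F-s) question of §2.2 is WHO SUPPLIES IT for a `V : HermSpace3 L ι₁`.

This leaf answers the kernel half of that question: **the embedding slot of the guard is immaterial, only the bit matters** —

* `kappa_starRingEnd_comp` — the type recipe transforms by conjugation: `κ_h(ῑ₁, c_L ∘ j)(τ) = conj ∘ κ_h(ι₁, j)(τ)` for every
  `τ` (on the automorphism orbit of `ι₁` = that of `ῑ₁` this is the centrality of `c_L` in `Aut L`, `SignRecipe.ringEquiv_map_conj` ∕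
  `ringEquiv_map_phiH`; off it, `τ ∘ c_L = τ̄`);
* `frameSign_starRingEnd_comp_left` — the frame sign flips in the distinguished slot: `s_{ῑ₁}(τ) = ! s_{ι₁}(τ)` (`IsRep` is symmetric);
* hence `reqPos_starRingEnd_comp` — the REQUIRED SIGNS agree: `reqPos h K L (c_L ∘ j) ῑ₁ Ψ τ = reqPos h K L j ι₁ Ψ τ` (the indicator of
  the CM type `Ψ` flips at `conj ∘ κ`, the frame sign flips, the two flips cancel), `signsForced_starRingEnd_comp_iff`, and
* **`goodCtx_starRingEnd_comp_iff : SignRecipe.GoodCtx h ῑ₁ c ↔ SignRecipe.GoodCtx h ι₁ c`** (the guard's `j` moves to `c_L ∘ j`);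
* with the bit flip `orientBitι L ῑ₁ = ! orientBitι L ι₁` (✔ `Model.orientBitι_conjugate`):
  **`goodCtx_orientBitι_starRingEnd_comp_iff : GoodCtx (orientBitι L ῑ₁) ῑ₁ c ↔ GoodCtx (! orientBitι L ι₁) ι₁ c`** — the primed
  sockets' guard IS the recipe guard of the OTHER BIT at the SAME embedding `ι₁`, i.e. (`thetaModel_goodCtx_iff`) the guard of the
  theta model of record instantiated at the bit `! orientBitι L ι₁` over the SAME `V : HermSpace3 L ι₁`
  (`thetaModel_not_orientBitι_goodCtx_iff`);
* consequences at such a context: the four slot lines ARE primed-good, `ῑ₁ ∈ Φ^δ(a_i)`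
  (`starRingEnd_comp_mem_lineType_slot_of_goodCtx_not`), and the (J4a) typing clause READ AT `ῑ₁` is inhabited on a Galois `L`
  (`liftTyped_lineType_starRingEnd_comp_of_goodCtx_not`) — the exact mirror of `Rekey/MuLiuConj` §4, where at TODAY's bit both fail;
* §6: at the flipped bit the pin's slot-positivity inputs `hpos₀..₃` hold iff `ι₁` is NOT the Mathlib representative of its place
  (tree (U3) `hpos_iff_eq_orientBitι_of_goodCtx_of_embedding_eq` and its CONJ branch): the primed OG guard is `GOG` READ AT `ῑ₁`,
  `(mk ι₁).embedding = ῑ₁ ∧ GoodCtx (orientBitι L ῑ₁) ῑ₁ c` (`primedGuard_iff`, `hpos_slot_of_primedGuard`), and TODAY's representative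
  clause `(mk ι₁).embedding = ι₁` together with the flipped-bit guard leaves no slot positivity (`not_hpos_slot_of_embedding_eq_of_goodCtx_not`).

So REKEY-FLIPSITES §2.2's «the supply must move with the key» reads, in the kernel: instantiate the `∀ h : Bool` supply at
`h := ! orientBitι L ι₁` (embedding and hermitian space unchanged); whether the supply theorems are available at that bit is the
theta lane's to say (own-htheta ∕ own-crow), not this file's.  KIND: kernel; theorems only (0 `def`, no named-fact hypothesis, no
`sorry`, nothing cited as a fact); expected `#print axioms` ⊆ {propext, Classical.choice, Quot.sound}.  All [folklore].
-/

noncomputable section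

open NumberField NumberField.ComplexEmbedding
open scoped ComplexConjugate
open Literature.AlgebraicGeometry.Motives (CMType)
open Literature.AlgebraicGeometry.ShimuraVarieties (conjRingHomK embedding_conjRingHomK)
open HodgeCM HodgeCM.SignRecipe

namespace Summit.HodgeConjecture.CorCM.Rekey

variable {K L : CMField}

/-! ## §1 Conjugation bookkeeping for embeddings of `K` through `L` -/

/-- `c_L ∘ c_L ∘ j = j`. [folklore] -/
theorem conjRingHomK_comp_conjRingHomK_comp (j : K →+* L) :
    (conjRingHomK L).comp ((conjRingHomK L).comp j) = j :=
  RingHom.ext fun x => by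
    simp only [RingHom.coe_comp, Function.comp_apply, SignRecipe.conjRingHomK_apply, IsCMField.complexConj_apply_apply]

/-- `ῑ₁ ∘ (c_L ∘ j) = ι₁ ∘ j`: conjugating the distinguished embedding and pre-composing `j` with `c_L` cancel. [folklore] -/
theorem starRingEnd_comp_comp_conjRingHomK_comp (ι₁ : L →+* ℂ) (j : K →+* L) :
    ((starRingEnd ℂ).comp ι₁).comp ((conjRingHomK L).comp j) = ι₁.comp j :=
  RingHom.ext fun x => by
    simp only [RingHom.coe_comp, Function.comp_apply]
    rw [embedding_conjRingHomK]
    exact Complex.conj_conj _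

/-- `ῑ₁ ∘ g = ι₁ ∘ (c_L ∘ g)` on automorphisms (`SignRecipe.comp_trans_conjEquiv`). [folklore] -/
theorem starRingEnd_comp_comp_gal (ι₁ : L →+* ℂ) (g : L ≃+* L) :
    ((starRingEnd ℂ).comp ι₁).comp g.toRingHom = ι₁.comp (g.trans (conjEquiv L)).toRingHom := by
  rw [comp_trans_conjEquiv]
  rfl

/-- `(g ∘ c_L) ∘ c_L = g`. [folklore] -/
theorem trans_conjEquiv_trans_conjEquiv (g : L ≃+* L) : (g.trans (conjEquiv L)).trans (conjEquiv L) = g :=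
  RingEquiv.ext fun x => by
    simp only [RingEquiv.coe_trans, Function.comp_apply, conjEquiv_apply, SignRecipe.conjRingHomK_apply,
      IsCMField.complexConj_apply_apply]

/-- the automorphism orbit of `ῑ₁` is the automorphism orbit of `ι₁`. [folklore] -/
theorem exists_gal_starRingEnd_comp_iff (ι₁ τ : L →+* ℂ) :
    (∃ g : L ≃+* L, ((starRingEnd ℂ).comp ι₁).comp g.toRingHom = τ) ↔ ∃ g : L ≃+* L, ι₁.comp g.toRingHom = τ := by
  constructor
  · rintro ⟨g, hg⟩
    exact ⟨g.trans (conjEquiv L), by rw [← starRingEnd_comp_comp_gal, hg]⟩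
  · rintro ⟨g, hg⟩
    refine ⟨g.trans (conjEquiv L), ?_⟩
    rw [starRingEnd_comp_comp_gal, trans_conjEquiv_trans_conjEquiv, hg]

/-! ## §2 The representative system and the frame sign flip in the DISTINGUISHED slot -/

/-- `IsRep` is symmetric in its two embeddings (`0 < Im τ(η) · Im ι₁(η)`). [folklore] -/
theorem isRep_comm (ι₁ τ : L →+* ℂ) : IsRep L ι₁ τ ↔ IsRep L τ ι₁ := by
  unfold IsRep
  rw [mul_comm]

-- (v4, muliuconj-b g1) `isRep_starRingEnd_comp_left_iff` DELETED here: it restated the meanwhile-landed ✔ `HodgeCM.SignRecipe.isRep_starRingEnd_comp_iff`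
-- (`CorCM/Rekey/Binders/LiftTypeConj.lean`, subcorner pair), now imported and used below (gate `dedup.landed`).

/-- **the frame sign flips in the distinguished slot**: `s_{ῑ₁}(τ) = ! s_{ι₁}(τ)`. [folklore] -/
theorem frameSign_starRingEnd_comp_left (ι₁ τ : L →+* ℂ) :
    frameSign L ((starRingEnd ℂ).comp ι₁) τ = !frameSign L ι₁ τ := by
  cases hs : frameSign L ι₁ τ
  · rw [Bool.not_false, frameSign_eq_true_iff, HodgeCM.SignRecipe.isRep_starRingEnd_comp_iff, ← frameSign_eq_true_iff, hs]
    exact Bool.false_ne_true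
  · rw [Bool.not_true, Bool.eq_false_iff, ne_eq, frameSign_eq_true_iff, HodgeCM.SignRecipe.isRep_starRingEnd_comp_iff, not_not,
      ← frameSign_eq_true_iff]
    exact hs

/-! ## §3 The type recipe under `(ι₁, j) ↦ (ῑ₁, c_L ∘ j)`: conjugated -/

/-- `c_L (φ^h (c_L x)) = φ^h x` (`φ^h ∈ {1, c_L}` commutes with `c_L`). [folklore] -/
theorem conjRingHomK_phiH_conjRingHomK (h : Bool) (x : L) :
    conjRingHomK L (phiH L h (conjRingHomK L x)) = phiH L h x := by
  have e := ringEquiv_map_phiH L h (conjEquiv L) (conjRingHomK L x)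
  simp only [conjEquiv_apply, SignRecipe.conjRingHomK_apply, IsCMField.complexConj_apply_apply] at e
  simpa only [SignRecipe.conjRingHomK_apply] using e

/-- **`κ_h(ῑ₁, c_L ∘ j)(τ) = conj ∘ κ_h(ι₁, j)(τ)`** for every `τ` and every bit `h`. [folklore] -/
theorem kappa_starRingEnd_comp (h : Bool) (j : K →+* L) (ι₁ τ : L →+* ℂ) :
    kappa h K L ((conjRingHomK L).comp j) ((starRingEnd ℂ).comp ι₁) τ = conjugate (kappa h K L j ι₁ τ) := by
  by_cases H : ∃ g : L ≃+* L, ι₁.comp g.toRingHom = τ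
  · obtain ⟨g, hg⟩ := H
    have hg' : ((starRingEnd ℂ).comp ι₁).comp (g.trans (conjEquiv L)).toRingHom = τ := by
      rw [starRingEnd_comp_comp_gal, trans_conjEquiv_trans_conjEquiv, hg]
    ext x
    rw [kappa_of_gal_apply h _ _ hg', conjugate_coe_eq, kappa_of_gal_apply h j g hg]
    simp only [RingHom.coe_comp, Function.comp_apply, RingEquiv.symm_trans_apply, conjEquiv_symm_apply,
      conjRingHomK_phiH_conjRingHomK]
  · have H' : ¬∃ g : L ≃+* L, ((starRingEnd ℂ).comp ι₁).comp g.toRingHom = τ := by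
      rwa [exists_gal_starRingEnd_comp_iff]
    rw [kappa_of_not_gal h _ H', kappa_of_not_gal h j H]
    ext x
    simp only [RingHom.coe_comp, Function.comp_apply, conjugate_coe_eq]
    exact embedding_conjRingHomK L τ (j x)

/-- the indicator of a CM type flips under conjugation of the argument. [folklore] -/
theorem ind_conjugate_eq_one_iff (Ψ : CMType K) (φ : K →+* ℂ) : ind Ψ (conjugate φ) = 1 ↔ ¬ind Ψ φ = 1 := by
  by_cases hφ : φ ∈ Ψ.1
  · rw [ind_of_mem hφ, ind_of_not_mem ((CMTypeOps.mem_iff_conjugate_notMem Ψ φ).1 hφ)]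
    simp
  · rw [ind_of_not_mem hφ, ind_of_mem ((CMTypeOps.conjugate_mem_iff_notMem Ψ φ).2 hφ)]
    simp

/-- **the required signs agree**: `reqPos h K L (c_L ∘ j) ῑ₁ Ψ τ = reqPos h K L j ι₁ Ψ τ` (indicator flip × frame-sign flip).
[folklore] -/
theorem reqPos_starRingEnd_comp (h : Bool) (j : K →+* L) (ι₁ : L →+* ℂ) (Ψ : CMType K) (τ : L →+* ℂ) :
    reqPos h K L ((conjRingHomK L).comp j) ((starRingEnd ℂ).comp ι₁) Ψ τ = reqPos h K L j ι₁ Ψ τ := by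
  unfold reqPos
  rw [kappa_starRingEnd_comp, frameSign_starRingEnd_comp_left]
  by_cases hk : ind Ψ (kappa h K L j ι₁ τ) = 1
  · rw [if_pos hk, if_neg ((ind_conjugate_eq_one_iff Ψ _).not.2 (not_not.2 hk)), Bool.not_not]
  · rw [if_neg hk, if_pos ((ind_conjugate_eq_one_iff Ψ _).2 hk)]

/-- **the forced signs agree**: `SignsForced h K L (c_L ∘ j) ῑ₁ Ψ D ↔ SignsForced h K L j ι₁ Ψ D`. [folklore] -/
theorem signsForced_starRingEnd_comp_iff (h : Bool) (j : K →+* L) (ι₁ : L →+* ℂ) (Ψ : Fin 4 → CMType K)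
    (D : StubTree.SeesawDatum L) :
    SignsForced h K L ((conjRingHomK L).comp j) ((starRingEnd ℂ).comp ι₁) Ψ D ↔ SignsForced h K L j ι₁ Ψ D := by
  unfold SignsForced
  simp only [reqPos_starRingEnd_comp]

/-! ## §4 The guard: only the bit matters -/

/-- **`SignRecipe.GoodCtx h ῑ₁ c ↔ SignRecipe.GoodCtx h ι₁ c`** for every bit `h` (the guard's `j` moves to `c_L ∘ j`; pair-sum,
injectivity and `c.σ ∈ Ψ_i` do not see the embedding). [folklore] -/
theorem goodCtx_starRingEnd_comp_iff (h : Bool) (ι₁ : L →+* ℂ) (c : SeesawCtx L) :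
    SignRecipe.GoodCtx h ((starRingEnd ℂ).comp ι₁) c ↔ SignRecipe.GoodCtx h ι₁ c := by
  constructor
  · rintro ⟨h₁, h₂, h₃, j, hj, hs⟩
    refine ⟨h₁, h₂, h₃, (conjRingHomK L).comp j, ?_, ?_⟩
    · rw [← starRingEnd_comp_comp_conjRingHomK_comp ι₁ ((conjRingHomK L).comp j), conjRingHomK_comp_conjRingHomK_comp, hj]
    · rw [← signsForced_starRingEnd_comp_iff, conjRingHomK_comp_conjRingHomK_comp]
      exact hs
  · rintro ⟨h₁, h₂, h₃, j, hj, hs⟩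
    exact ⟨h₁, h₂, h₃, (conjRingHomK L).comp j, by rw [starRingEnd_comp_comp_conjRingHomK_comp, hj],
      (signsForced_starRingEnd_comp_iff h j ι₁ c.Ψ c.D).2 hs⟩

/-- the theta supply's bit FLIPS with the key: `orientBitι L ῑ₁ = ! orientBitι L ι₁` (✔ `Model.orientBitι_conjugate`, restated at
the chain's spelling). [folklore] -/
theorem orientBitι_starRingEnd_comp' (ι₁ : L →+* ℂ) :
    Model.orientBitι L ((starRingEnd ℂ).comp ι₁) = !Model.orientBitι L ι₁ :=
  Model.orientBitι_conjugate

/-- **THE PRIMED SOCKETS' GUARD IS THE OTHER BIT'S GUARD AT THE SAME EMBEDDING**: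
`GoodCtx (orientBitι L ῑ₁) ῑ₁ c ↔ GoodCtx (! orientBitι L ι₁) ι₁ c`. [folklore] -/
theorem goodCtx_orientBitι_starRingEnd_comp_iff (ι₁ : L →+* ℂ) (c : SeesawCtx L) :
    SignRecipe.GoodCtx (Model.orientBitι L ((starRingEnd ℂ).comp ι₁)) ((starRingEnd ℂ).comp ι₁) c ↔
      SignRecipe.GoodCtx (!Model.orientBitι L ι₁) ι₁ c := by
  rw [goodCtx_starRingEnd_comp_iff, orientBitι_starRingEnd_comp']

/-- … and symmetrically `GoodCtx (! orientBitι L ῑ₁) ῑ₁ c ↔ GoodCtx (orientBitι L ι₁) ι₁ c` (today's guard, read at `ῑ₁`). [folklore] -/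
theorem goodCtx_not_orientBitι_starRingEnd_comp_iff (ι₁ : L →+* ℂ) (c : SeesawCtx L) :
    SignRecipe.GoodCtx (!Model.orientBitι L ((starRingEnd ℂ).comp ι₁)) ((starRingEnd ℂ).comp ι₁) c ↔
      SignRecipe.GoodCtx (Model.orientBitι L ι₁) ι₁ c := by
  rw [goodCtx_starRingEnd_comp_iff, orientBitι_starRingEnd_comp', Bool.not_not]

/-! ## §5 Consequences at a good context of the flipped bit -/

/-- at a good context of the FLIPPED bit for `ι₁` the four slot lines ARE primed-good: `ῑ₁ ∈ Φ^δ(a_i)`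
(✔ `GoodCtx.self_mem_lineType` at `ῑ₁`). [folklore] -/
theorem starRingEnd_comp_mem_lineType_slot_of_goodCtx_not {ι₁ : L →+* ℂ} {c : SeesawCtx L}
    (hc : SignRecipe.GoodCtx (!Model.orientBitι L ι₁) ι₁ c) (i : Fin 4) :
    (starRingEnd ℂ).comp ι₁ ∈ (lineType (c.D.a i) (c.D.a_real i) (c.D.a_ne i)).1 :=
  GoodCtx.self_mem_lineType ((goodCtx_orientBitι_starRingEnd_comp_iff ι₁ c).2 hc) i

/-- … hence today's embedding is NOT in the slot types there: `ι₁ ∉ Φ^δ(a_i)`. [folklore] -/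
theorem self_not_mem_lineType_slot_of_goodCtx_not {ι₁ : L →+* ℂ} {c : SeesawCtx L}
    (hc : SignRecipe.GoodCtx (!Model.orientBitι L ι₁) ι₁ c) (i : Fin 4) :
    ι₁ ∉ (lineType (c.D.a i) (c.D.a_real i) (c.D.a_ne i)).1 :=
  (CMTypeOps.conjugate_mem_iff_notMem _ ι₁).1 (starRingEnd_comp_mem_lineType_slot_of_goodCtx_not hc i)

/-- **the (J4a) typing clause READ AT `ῑ₁` is inhabited at a good context of the flipped bit** (Galois `L`;
✔ `GoodCtx.liftTyped_lineType` at `ῑ₁`) — the input the primed sockets `HsmallOfTowerAt{LiftType,LineType,LineTypeEq}′` ∕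
`HsmallOfBlockAt′` consume. [folklore] -/
theorem liftTyped_lineType_starRingEnd_comp_of_goodCtx_not [IsGalois ℚ L] {ι₁ : L →+* ℂ} {c : SeesawCtx L}
    (hc : SignRecipe.GoodCtx (!Model.orientBitι L ι₁) ι₁ c) (i : Fin 4) :
    ∃ j : c.K →+* L, ((starRingEnd ℂ).comp ι₁).comp j = c.σ ∧
      lineType (c.D.a i) (c.D.a_real i) (c.D.a_ne i) = liftType false c.K L j ((starRingEnd ℂ).comp ι₁) (c.Ψ i) :=
  GoodCtx.liftTyped_lineType ((goodCtx_orientBitι_starRingEnd_comp_iff ι₁ c).2 hc) i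

/-- **THE SUPPLIER, NAMED**: for ANY adèlic theta core `C` and side data, the theta model of record instantiated at the bit
`! orientBitι L ι₁` has, at the SAME embedding `ι₁`, exactly the primed sockets' guard:
`(C.thetaModel (! orientBitι L ι₁) d12 d34).GoodCtx ι₁ c ↔ GoodCtx (orientBitι L ῑ₁) ῑ₁ c` (✔ `thetaModel_goodCtx_iff`). [folklore] -/
theorem thetaModel_not_orientBitι_goodCtx_iff {U : Universe} {hP : PrintFact_unitaryCompact} (C : U.AdelicThetaCore hP)
    (d12 d34 : ∀ {L : CMField}, SeesawCtx L → Universe.SideData L) (ι₁ : L →+* ℂ) (c : SeesawCtx L) :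
    (C.thetaModel (!Model.orientBitι L ι₁) d12 d34).GoodCtx ι₁ c ↔
      SignRecipe.GoodCtx (Model.orientBitι L ((starRingEnd ℂ).comp ι₁)) ((starRingEnd ℂ).comp ι₁) c :=
  (C.thetaModel_goodCtx_iff _ d12 d34 ι₁ c).trans (goodCtx_orientBitι_starRingEnd_comp_iff ι₁ c).symm

/-! ## §6 Slot positivity at the flipped bit wants the ANTI-canonical representative (tree (U3) ∕ its CONJ branch)

The theta pin of record (`ThetaAdelicSideReadOff.SROG`) discharges its four slot-positivity inputs `hpos₀..₃` — «line `⟨a_i⟩` is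
block-POSITIVE at `w₁`», `0 < cmXW … (cmPlace ι₁) 0` — from the OG guard `GOG V c := (mk ι₁).embedding = ι₁ ∧ GoodCtx (orientBitι L ι₁) ι₁ c`
via ✔ `hpos_iff_eq_orientBitι_of_goodCtx_of_embedding_eq` («`hpos ↔ h = orientBitι L ι₁`» at the canonical representative).  At the
FLIPPED bit the same tree lemma and its CONJ branch ✔ `hpos_iff_eq_not_orientBitι_of_goodCtx_of_embedding_ne` say: `hpos` holds iff `ι₁` is
NOT the Mathlib representative of its place, i.e. iff `(mk ι₁).embedding = ῑ₁`.  So the primed OG guard is `GOG` READ AT `ῑ₁`: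
`(mk ι₁).embedding = ῑ₁ ∧ GoodCtx (orientBitι L ῑ₁) ῑ₁ c` (same `V : HermSpace3 L ι₁`, same place `mk ῑ₁ = mk ι₁`), and under TODAY's
representative clause `(mk ι₁).embedding = ι₁` the flipped-bit slots are block-NEGATIVE (no `hpos`). -/

/-- the anti-canonical representative IS `ῑ₁`: `(mk ι₁).embedding ≠ ι₁ ↔ (mk ι₁).embedding = ῑ₁` (`L` is totally complex). [folklore] -/
theorem embedding_mk_ne_self_iff (ι₁ : L →+* ℂ) :
    (InfinitePlace.mk ι₁).embedding ≠ ι₁ ↔ (InfinitePlace.mk ι₁).embedding = (starRingEnd ℂ).comp ι₁ := by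
  constructor
  · exact fun h => (InfinitePlace.embedding_mk_eq ι₁).resolve_left h
  · intro h h'
    have hc : (InfinitePlace.mk ι₁).IsComplex := IsTotallyComplex.isComplex _
    rw [InfinitePlace.isComplex_iff, h'] at hc
    exact hc (show conjugate ι₁ = ι₁ from h.symm.trans h')

/-- **under the flipped-bit guard, slot `i` is block-POSITIVE at `w₁` iff `ι₁` is NOT the representative of its place** (tree (U3) both
branches). [folklore] -/
theorem hpos_slot_iff_embedding_ne_of_goodCtx_not {ι₁ : L →+* ℂ} (V : HermSpace3 L ι₁) {c : SeesawCtx L}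
    (hc : SignRecipe.GoodCtx (!Model.orientBitι L ι₁) ι₁ c) (i : Fin 4) :
    0 < Model.HypCensus.cmXW (L : Type) (Model.frameD V) (Literature.NumberTheory.GelbartRogawski1991.UnitaryDualPair.lineVec (L : Type) (c.D.a i)) (fun _ => c.D.a_real i) ι₁
        (Model.HypCensus.cmPlace (L : Type) ι₁) 0 ↔
      (InfinitePlace.mk ι₁).embedding ≠ ι₁ := by
  by_cases heq : (InfinitePlace.mk ι₁).embedding = ι₁
  · rw [Model.hpos_iff_eq_orientBitι_of_goodCtx_of_embedding_eq V heq hc i (c.D.a_real i)]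
    simp only [ne_eq, heq, not_true_eq_false, iff_false]
    cases Model.orientBitι L ι₁ <;> decide
  · rw [Model.hpos_iff_eq_not_orientBitι_of_goodCtx_of_embedding_ne V heq hc i (c.D.a_real i)]
    exact iff_of_true rfl heq

/-- hence TODAY's representative clause and the flipped-bit guard together leave NO slot positivity: under
`(mk ι₁).embedding = ι₁ ∧ GoodCtx (! orientBitι L ι₁) ι₁ c` every slot line is block-negative at `w₁`. [folklore] -/
theorem not_hpos_slot_of_embedding_eq_of_goodCtx_not {ι₁ : L →+* ℂ} (V : HermSpace3 L ι₁) {c : SeesawCtx L}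
    (heq : (InfinitePlace.mk ι₁).embedding = ι₁) (hc : SignRecipe.GoodCtx (!Model.orientBitι L ι₁) ι₁ c) (i : Fin 4) :
    ¬0 < Model.HypCensus.cmXW (L : Type) (Model.frameD V) (Literature.NumberTheory.GelbartRogawski1991.UnitaryDualPair.lineVec (L : Type) (c.D.a i)) (fun _ => c.D.a_real i) ι₁
        (Model.HypCensus.cmPlace (L : Type) ι₁) 0 :=
  fun h => ((hpos_slot_iff_embedding_ne_of_goodCtx_not V hc i).1 h) heq

/-- **the primed OG guard is `GOG` read at `ῑ₁`**: «anti-canonical representative ∧ flipped-bit guard at `ι₁`» ↔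
«`(mk ι₁).embedding = ῑ₁ ∧ GoodCtx (orientBitι L ῑ₁) ῑ₁ c`», under which all four slots ARE block-positive at `w₁`. [folklore] -/
theorem primedGuard_iff (ι₁ : L →+* ℂ) (c : SeesawCtx L) :
    ((InfinitePlace.mk ι₁).embedding ≠ ι₁ ∧ SignRecipe.GoodCtx (!Model.orientBitι L ι₁) ι₁ c) ↔
      ((InfinitePlace.mk ι₁).embedding = (starRingEnd ℂ).comp ι₁ ∧
        SignRecipe.GoodCtx (Model.orientBitι L ((starRingEnd ℂ).comp ι₁)) ((starRingEnd ℂ).comp ι₁) c) := by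
  rw [embedding_mk_ne_self_iff, goodCtx_orientBitι_starRingEnd_comp_iff]

/-- … and under it the four slot-positivity inputs of the pin HOLD (over the SAME `V : HermSpace3 L ι₁`). [folklore] -/
theorem hpos_slot_of_primedGuard {ι₁ : L →+* ℂ} (V : HermSpace3 L ι₁) {c : SeesawCtx L}
    (hc : (InfinitePlace.mk ι₁).embedding = (starRingEnd ℂ).comp ι₁ ∧
      SignRecipe.GoodCtx (Model.orientBitι L ((starRingEnd ℂ).comp ι₁)) ((starRingEnd ℂ).comp ι₁) c) (i : Fin 4) :
    0 < Model.HypCensus.cmXW (L : Type) (Model.frameD V) (Literature.NumberTheory.GelbartRogawski1991.UnitaryDualPair.lineVec (L : Type) (c.D.a i)) (fun _ => c.D.a_real i) ι₁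
        (Model.HypCensus.cmPlace (L : Type) ι₁) 0 := by
  rw [← primedGuard_iff] at hc
  exact (hpos_slot_iff_embedding_ne_of_goodCtx_not V hc.2 i).2 hc.1

/-! ## §7 The primed guard at the CONJUGATE presentation is today's guard

Read at the conjugate presentation `ι₁ ↦ ῑ₁` (a `V' : HermSpace3 L ῑ₁` only indexes the embedding), the primed guard of §6 —
«anti-canonical representative ∧ flipped-bit recipe context» — is literally TODAY's OG data at `ι₁`: the representative clause
`(mk ῑ₁).embedding ≠ ῑ₁ ↔ (mk ι₁).embedding = ι₁` and `GoodCtx (! orientBitι L ῑ₁) ῑ₁ c ↔ GoodCtx (orientBitι L ι₁) ι₁ c`.  So the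
primed sockets are fed by today's supply exactly at the presentations conjugate to the canonical ones — where the port's row-15
holomorphy input is its open (TWIST-2) branch (`ArchKTypeOfSlotRec_1` :182), not a theorem. -/

/-- `(mk ῑ₁).embedding ≠ ῑ₁ ↔ (mk ι₁).embedding = ι₁`. [folklore] -/
theorem embedding_mk_starRingEnd_comp_ne_iff (ι₁ : L →+* ℂ) :
    (InfinitePlace.mk ((starRingEnd ℂ).comp ι₁)).embedding ≠ (starRingEnd ℂ).comp ι₁ ↔ (InfinitePlace.mk ι₁).embedding = ι₁ := by
  rw [embedding_mk_ne_self_iff, show (starRingEnd ℂ).comp ((starRingEnd ℂ).comp ι₁) = ι₁ from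
    RingHom.ext fun x => Complex.conj_conj _, show InfinitePlace.mk ((starRingEnd ℂ).comp ι₁) = InfinitePlace.mk ι₁ from
    InfinitePlace.mk_conjugate_eq ι₁]

/-- **the primed guard at the conjugate presentation IS today's OG data**:
`((mk ῑ₁).embedding ≠ ῑ₁ ∧ GoodCtx (! orientBitι L ῑ₁) ῑ₁ c) ↔ ((mk ι₁).embedding = ι₁ ∧ GoodCtx (orientBitι L ι₁) ι₁ c)`. [folklore] -/
theorem primedGuard_starRingEnd_comp_iff (ι₁ : L →+* ℂ) (c : SeesawCtx L) :
    ((InfinitePlace.mk ((starRingEnd ℂ).comp ι₁)).embedding ≠ (starRingEnd ℂ).comp ι₁ ∧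
        SignRecipe.GoodCtx (!Model.orientBitι L ((starRingEnd ℂ).comp ι₁)) ((starRingEnd ℂ).comp ι₁) c) ↔
      ((InfinitePlace.mk ι₁).embedding = ι₁ ∧ SignRecipe.GoodCtx (Model.orientBitι L ι₁) ι₁ c) := by
  rw [embedding_mk_starRingEnd_comp_ne_iff, goodCtx_not_orientBitι_starRingEnd_comp_iff]

end Summit.HodgeConjecture.CorCM.Rekey

end
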